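import Summits.QuantumFields.YangMills.Theses.ColdStartUniversality
import Summits.QuantumFields.YangMills.Theorems.ColdStartUniversalityUniformColdStartMixingFixedCutoffEntropy
import Summits.QuantumFields.YangMills.Theorems.ColdStartUniversalityUniformColdStartMixingPinskerStep
import Summits.QuantumFields.YangMills.Theorems.ColdStartUniversalityUniformColdStartMixingCesaroStep
import Summits.QuantumFields.YangMills.Theorems.ColdStartUniversalityUniformColdStartMixingWeylEntropySum
import Summits.QuantumFields.YangMills.Theorems.ColdStartUniversalityUniformColdStartMixingOUModeEntropy
import Mathlib.Probability.Distributions.Gaussian.Real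
import Mathlib.InformationTheory.KullbackLeibler.Basic
import HarnessLib

/-!
# Route `ColdStartUniversality`, crux K_A1 `UniformColdStartMixing` (stmt-QuantumFields-24809), LINE 4 «cold_entropy»:
# FIVE registered stubs BY NAME AND SIGNATURE — `stub_pinskerStep`, `stub_cesaroOfPointwise`, `stub_fixedCutoffEntropy`,
# `stub_weylEntropySum`, `stub_ouModeEntropy`

This file reproduces the registered skeleton `Lines_cold_entropy.lean` (planner ym-idea-5 g5, skeleton sha256 58f1be9b678ab87b…)
VERBATIM from its `namespace` line to `end __Registered` (local abbreviations `G2`, `su2Rep`, `avSU`, `toField`, `obsK`,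
`eqExpect`, `IsColdStartSol`, `gibbsK`, `lawAt`, `entAt`, the seven node `Prop`s and the `__Registered.*` aliases), so that each
`__Registered.stub_X` IS the registered Prop, and closes five of the seven by the tree theorems of seat `ym-line-csu-p1`
(statements = the nodes with the abbreviations unfolded; the proofs here are definitional unfoldings):

* `stub_pinskerStep := Theorems.ColdStartUniversality.pinskerStep` (Pinsker for `klDiv` + bookkeeping; g4),
* `stub_cesaroOfPointwise := Theorems.ColdStartUniversality.cesaroStep` (pointwise ⇒ Cesàro, the node shared with `birth`; g4),
* `stub_fixedCutoffEntropy := Theorems.ColdStartUniversality.fixedCutoffEntropy` (THE RUNG: fixed-cut-off entropy budget + decay,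
  from uniform exponential mixing `exp_mixing_szz`, the uniform density bound `map_le_smul_haar_of_le` and the density-bound
  entropy lemmas `KLDensity.*`; no log-Sobolev input; g10),
* `stub_weylEntropySum := Theorems.ColdStartUniversality.weylEntropySum` (the Weyl-law Gaussian lattice sum; g4),
* `stub_ouModeEntropy := Theorems.ColdStartUniversality.ouModeEntropy` (the one-mode OU entropy; g4).

Also recorded: the skeleton's kernel `UniformColdStartMixing_of` (verbatim) and its corollary
`uniformColdStartMixing_of_budget_of_dissipation` — the crux BY NAME now rests on exactly the two K-UNIFORM stubs
`stub_coldEntropyBudget` (XL/L) and `stub_entropyDissipation` (XL), which are NOT proved here.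

HONEST FRAMING: item 24809 is ASIDE (route rev ≥ 3 replaced it by the centre-neutral crux 27363); the two load-bearing
K-uniform stubs are untouched; no crux, route, rung R3 or summit is proved; the Yang–Mills mass gap is NOT proved.
-/

namespace Summit.QuantumFields.YangMills.Cruxes.UniformColdStartMixing.ColdEntropy

open scoped BigOperators Topology Classical MeasureTheory ProbabilityTheory NNReal ENNReal
open Filter Set Function MeasureTheory InformationTheory
open Literature.MathematicalPhysics.QuantumFieldTheory
open Literature.MathematicalPhysics.QuantumFieldTheory.Balaban1983to89
open Literature.MathematicalPhysics.QuantumLattice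

/-- The gauge group `SU(2)` as `2 × 2` complex matrices. -/
abbrev G2 : Type := Matrix.specialUnitaryGroup (Fin 2) ℂ

/-- The SZZ lattice representation datum of `SU(2)` in its defining representation (verbatim from the crux). -/
noncomputable abbrev su2Rep : LatticeRep G2 :=
  ⟨2, fundamentalRep (Fin 2), continuous_fundamentalRep _, fundamentalRep_injective _, fundamentalRep_mem_unitaryGroup⟩

/-- Bałaban's small-loop average used by the leaf (`expMeanLogSU`). -/
noncomputable abbrev avSU : LoopAverage G2 := ExpMeanLog.expMeanLogSU

variable (F : T3ContinuumYM3Torus.T3Family)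

/-- A step-`K` link configuration read as a level-0 gauge field of Bałaban's `K`-th lattice (verbatim from the crux). -/
def toField (K : ℕ) (c : GaugeConfig 3 ((F.P K).sitesPerDir 0) G2) : GaugeField (F.P K) 0 G2 :=
  fun b : PBond (F.P K) 0 => c (b.src, b.dir)

/-- The crux's integrand: the product over the loop string `os` of the unit-scale averaged loop variables (verbatim from line
`unitscale_coupling`, so that the shared nodes match). -/
noncomputable def obsK (K : ℕ) (os : List (T3ContinuumYM3Torus.ULoop3 F))
    (c : GaugeConfig 3 ((F.P K).sitesPerDir 0) G2) : ℝ :=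
  (os.map fun C => F.avgObs avSU K C (toField F K c)).prod

/-- Bałaban's step-`K` Gibbs expectation of the loop string (the crux's `expectAt`; verbatim from line `unitscale_coupling`). -/
noncomputable def eqExpect (γ : ℝ) (K : ℕ) (os : List (T3ContinuumYM3Torus.ULoop3 F)) : ℝ :=
  (F.scheme avSU γ).expectAt K os

/-- «`U` is a cold-start strong solution» (verbatim from the crux: the start is `1`). -/
def IsColdStartSol (γ : ℝ) (K : ℕ) {Ω : Type} [MeasurableSpace Ω] (P : Measure Ω)
    (W : ℝ≥0 → Ω → (Edge 3 ((F.P K).sitesPerDir 0) × NoiseIdx 2 → ℝ)) (hW : IsFlatBrownian W P)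
    (U : ℝ≥0 → Ω → GaugeConfig 3 ((F.P K).sitesPerDir 0) G2) : Prop :=
  (∀ ω, U 0 ω = fun _ => 1) ∧
    (latticeLangevinDynamics su2Rep ((γ * (F.P K).eps)⁻¹ / 2)).IsSolution (fundamentalRep (Fin 2))
      hW.natFiltration P W U

/-! ## The entropy functional along the flow -/

/-- Bałaban's step-`K` Gibbs measure of the leaf's scheme (the Wilson–Gibbs law on level-0 fields at `β_K = (F.scheme avSU γ).β K`;
the measure whose loop-string integrals are `expectAt K`, `T4GenFunBounds.expectAt_eq_integral_gibbs`). -/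
noncomputable def gibbsK (γ : ℝ) (K : ℕ) : Measure (GaugeField (F.P K) 0 G2) :=
  T4GenFunBounds.gibbsMeasure (F.P K) ((F.scheme avSU γ).β K)

/-- The ONE-TIME LAW of a process at PHYSICAL time `s` (lattice time `s/ε_K`), as a measure on level-0 gauge fields. -/
noncomputable def lawAt (K : ℕ) {Ω : Type} [MeasurableSpace Ω] (P : Measure Ω)
    (U : ℝ≥0 → Ω → GaugeConfig 3 ((F.P K).sitesPerDir 0) G2) (s : ℝ) : Measure (GaugeField (F.P K) 0 G2) :=
  Measure.map (fun ω => toField F K (U (s / (F.P K).eps).toNNReal ω)) P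

/-- THE LYAPUNOV FUNCTIONAL: relative entropy of the time-`s` law with respect to the step-`K` Gibbs measure
(`InformationTheory.klDiv`, `ℝ≥0∞`-valued: `∞` unless absolutely continuous with integrable log-likelihood ratio). -/
noncomputable def entAt (γ : ℝ) (K : ℕ) {Ω : Type} [MeasurableSpace Ω] (P : Measure Ω)
    (U : ℝ≥0 → Ω → GaugeConfig 3 ((F.P K).sitesPerDir 0) G2) (s : ℝ) : ℝ≥0∞ :=
  klDiv (lawAt F K P U s) (gibbsK F γ K)

/-! ## The nodes of the line -/

/-- NODE (SHARED verbatim with lines `birth` (`stub_pointwiseUniformMixing`) and `unitscale_coupling`): K-UNIFORM POINTWISE MIXING. -/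
def PointwiseMixing : Prop :=
  ∃ γ₁ : ℝ, 0 < γ₁ ∧ ∀ (F : T3ContinuumYM3Torus.T3Family) (γ : ℝ), 0 < γ → γ ≤ γ₁ →
    ∀ (os : List (T3ContinuumYM3Torus.ULoop3 F)) (η : ℝ), 0 < η →
      ∃ Tc : ℝ, 0 < Tc ∧ ∃ K₀ : ℕ, ∀ K : ℕ, K₀ ≤ K →
        ∀ (Ω : Type) (mΩ : MeasurableSpace Ω) (P : Measure Ω) (_ : IsProbabilityMeasure P)
          (W : ℝ≥0 → Ω → (Edge 3 ((F.P K).sitesPerDir 0) × NoiseIdx 2 → ℝ)) (hW : IsFlatBrownian W P)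
          (U : ℝ≥0 → Ω → GaugeConfig 3 ((F.P K).sitesPerDir 0) G2),
          IsColdStartSol F γ K P W hW U →
            ∀ s : ℝ, Tc ≤ s →
              |eqExpect F γ K os - ∫ ω, obsK F K os (U (s / (F.P K).eps).toNNReal ω) ∂P| ≤ η

/-- NODE (SHARED verbatim with lines `birth` / `unitscale_coupling`): CESÀRO STEP. -/
def CesaroStep : Prop :=
  PointwiseMixing → Summit.QuantumFields.YangMills.Theses.ColdStartUniversality.UniformColdStartMixing

/-- NODE — THE LEVER: K-UNIFORM COLD-START ENTROPY BUDGET AT A POSITIVE FLOW TIME.  At weak coupling there are a physical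
time `s₀ > 0` and a budget `H₀` such that for all fine enough cut-offs and EVERY cold-start solution the law at time `s₀` has
relative entropy `≤ H₀` with respect to the step-`K` Gibbs measure.  FINITE-TIME regularity of the flow from the classical vacuum
(no mixing content: `s₀` is fixed); the `K`-uniformity is the Weyl-law budget of the UV modes + lattice-rate relaxation of gauge
modes + finitely many zero modes.  `H₀` may depend on `γ` (zero modes: `~log(1/γ)`). -/
def ColdEntropyBudget : Prop :=
  ∃ γ₁ : ℝ, 0 < γ₁ ∧ ∀ (F : T3ContinuumYM3Torus.T3Family) (γ : ℝ), 0 < γ → γ ≤ γ₁ →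
    ∃ s₀ H₀ : ℝ, 0 < s₀ ∧ 0 ≤ H₀ ∧ ∃ K₀ : ℕ, ∀ K : ℕ, K₀ ≤ K →
      ∀ (Ω : Type) (mΩ : MeasurableSpace Ω) (P : Measure Ω) (_ : IsProbabilityMeasure P)
        (W : ℝ≥0 → Ω → (Edge 3 ((F.P K).sitesPerDir 0) × NoiseIdx 2 → ℝ)) (hW : IsFlatBrownian W P)
        (U : ℝ≥0 → Ω → GaugeConfig 3 ((F.P K).sitesPerDir 0) G2),
        IsColdStartSol F γ K P W hW U →
          entAt F γ K P U s₀ ≤ ENNReal.ofReal H₀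

/-- NODE — K-UNIFORM ENTROPY DISSIPATION ALONG THE COLD-START FLOW (log-Sobolev type).  At weak coupling, for every budget `H₀`
and target `η > 0` there is a physical time `T` such that for all fine enough cut-offs and every cold-start solution: if the
law at some time `t₀` has entropy `≤ H₀`, then at ALL times `s ≥ t₀ + T` the entropy is `≤ η`.  (Entropy is non-increasing along
a Markov flow with invariant `μ_K` — data processing — and a K-uniform log-Sobolev inequality for `μ_K` in PHYSICAL time,
`T = c_LS · log(H₀/η)`, is the named sufficient input: the lattice-YM₃ analogue of Bauerschmidt–Dagallier's `ε`-uniform LSI for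
`φ⁴₃`.  Weaker-than-LSI decay profiles also suffice.)  `T` may depend on `γ` (torons diffuse at rate `~γ`). -/
def EntropyDissipation : Prop :=
  ∃ γ₁ : ℝ, 0 < γ₁ ∧ ∀ (F : T3ContinuumYM3Torus.T3Family) (γ : ℝ), 0 < γ → γ ≤ γ₁ →
    ∀ (H₀ η : ℝ), 0 ≤ H₀ → 0 < η →
      ∃ T : ℝ, 0 < T ∧ ∃ K₀ : ℕ, ∀ K : ℕ, K₀ ≤ K →
        ∀ (Ω : Type) (mΩ : MeasurableSpace Ω) (P : Measure Ω) (_ : IsProbabilityMeasure P)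
          (W : ℝ≥0 → Ω → (Edge 3 ((F.P K).sitesPerDir 0) × NoiseIdx 2 → ℝ)) (hW : IsFlatBrownian W P)
          (U : ℝ≥0 → Ω → GaugeConfig 3 ((F.P K).sitesPerDir 0) G2),
          IsColdStartSol F γ K P W hW U →
            ∀ t₀ : ℝ, 0 ≤ t₀ → entAt F γ K P U t₀ ≤ ENNReal.ofReal H₀ →
              ∀ s : ℝ, t₀ + T ≤ s → entAt F γ K P U s ≤ ENNReal.ofReal η

/-- NODE (classical, L): budget + dissipation ⇒ K-uniform pointwise mixing of every loop string.  Inside: Csiszár–Kullback–Pinsker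
`‖law − μ_K‖_TV ≤ √(2·KL)` for `klDiv` (finite ⇒ `≪` and integrable llr), `|obsK| ≤ 1` (`abs_avgObs_le_one`) so
`|∫ obsK dlaw − ∫ obsK dμ_K| ≤ 2‖·‖_TV`, the change of variables `∫ obsK d(lawAt) = E obsK(U_s)` (`integral_map`, measurability of
`avgObs`), `eqExpect = ∫ obsK dμ_K` (`T4GenFunBounds.expectAt_eq_integral_gibbs`, `0 ≤ β_K`), and the bookkeeping
`γ₁ := min`, `K₀ := max`, `Tc := s₀ + T(H₀, η²/8)`. -/
def PinskerStep : Prop :=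
  ColdEntropyBudget → EntropyDissipation → PointwiseMixing

/-- RUNG NODE (fixed cut-off, classical; not in the chain): at ONE step `K` the cold-start flow has a finite entropy at some
positive time and dissipates it — the SZZ diffusion on the compact connected Lie group `SU(2)^E` is elliptic with the smooth
positive invariant density of `μ_K` (SZZ Lemma 3.3), so the time-`s₀` law has a bounded log-density (heat-kernel bounds), and
`μ_K` satisfies a log-Sobolev inequality (Rothaus / Bakry–Émery on `SU(2)` + Holley–Stroock), whence exponential entropy decay
and monotonicity.  Constants depend on `K`.  Exercises `entAt`, `lawAt`, `gibbsK`, `klDiv` in a decided regime. -/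
def FixedCutoffEntropy : Prop :=
  ∀ (F : T3ContinuumYM3Torus.T3Family) (γ : ℝ), 0 < γ → ∀ K : ℕ,
    ∃ s₀ H₀ : ℝ, 0 < s₀ ∧ 0 ≤ H₀ ∧
      ∀ η : ℝ, 0 < η → ∃ T : ℝ, 0 < T ∧
        ∀ (Ω : Type) (mΩ : MeasurableSpace Ω) (P : Measure Ω) (_ : IsProbabilityMeasure P)
          (W : ℝ≥0 → Ω → (Edge 3 ((F.P K).sitesPerDir 0) × NoiseIdx 2 → ℝ)) (hW : IsFlatBrownian W P)
          (U : ℝ≥0 → Ω → GaugeConfig 3 ((F.P K).sitesPerDir 0) G2),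
          IsColdStartSol F γ K P W hW U →
            entAt F γ K P U s₀ ≤ ENNReal.ofReal H₀ ∧ ∀ s : ℝ, s₀ + T ≤ s → entAt F γ K P U s ≤ ENNReal.ofReal η

/-- SUPPORT NODE (provable now, M; not in the chain): THE WEYL-LAW ENTROPY SUM — the free-field cold-start budget is a Gaussian
lattice sum over the momentum box, bounded UNIFORMLY IN THE BOX SIZE (i.e. in the cut-off): `Σ_{k ∈ [-n,n]³} e^{-c|k|²} ≤ B(c)` for
all `n`.  (Per mode, the KL divergence of the OU law started at `0` at time `s₀` from its equilibrium is `≤ e^{-4κ_k s₀}/2` with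
`κ_k ~ |k|²`; this sum is the `K`-uniform part of `stub_coldEntropyBudget`'s heuristic.) -/
def WeylEntropySum : Prop :=
  ∀ c : ℝ, 0 < c → ∃ B : ℝ, ∀ n : ℕ,
    (∑ k ∈ (Finset.Icc (-(n : ℤ)) n) ×ˢ ((Finset.Icc (-(n : ℤ)) n) ×ˢ (Finset.Icc (-(n : ℤ)) n)),
        Real.exp (-(c * ((k.1 : ℝ) ^ 2 + (k.2.1 : ℝ) ^ 2 + (k.2.2 : ℝ) ^ 2)))) ≤ B

/-- SUPPORT NODE (provable now, M; not in the chain; first rung of the lever per VERDICT #49 (3)): THE ONE-MODE OU ENTROPY — the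
Ornstein–Uhlenbeck mode `dX = -κ X ds + σ dB` started at `0` has law `N(0, v(1 - e^{-2κs}))` at time `s` (`v = σ²/2κ` its
equilibrium variance), and its relative entropy w.r.t. equilibrium is `½(-x - log(1-x)) ≤ x²/(4(1-x))`, `x = e^{-2κs}`:
DOUBLY exponentially small in the relaxation rate — the per-mode input of the Weyl sum.  (The exact Gaussian KL formula is
`toReal_klDiv_gaussianReal` in `Literature/Probability/MarkovChains/LangevinStepBias.lean`, private there — re-prove or expose.) -/
def OUModeEntropy : Prop :=
  ∀ (v : ℝ≥0), v ≠ 0 → ∀ κ s : ℝ, 0 < κ → 0 < s →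
    InformationTheory.klDiv (ProbabilityTheory.gaussianReal 0 (v * (1 - Real.exp (-(2 * κ * s))).toNNReal))
        (ProbabilityTheory.gaussianReal 0 v)
      ≤ ENNReal.ofReal (Real.exp (-(4 * κ * s)) / (4 * (1 - Real.exp (-(2 * κ * s)))))

/-! ## Registered stub signatures (convention of this seat: `__Registered` aliases; `_of` hypotheses by these names) -/

namespace __Registered

/-- XL/L — THE LEVER: K-uniform cold-start entropy budget at a positive flow time. -/
abbrev stub_coldEntropyBudget : Prop := ColdEntropyBudget
/-- XL — K-uniform entropy dissipation along the cold-start flow (LSI-type). -/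
abbrev stub_entropyDissipation : Prop := EntropyDissipation
/-- L — Pinsker + bookkeeping ⇒ the shared node `PointwiseMixing`. -/
abbrev stub_pinskerStep : Prop := PinskerStep
/-- M/L — SHARED with `birth` / `unitscale_coupling` (same name as in `unitscale_coupling`): the Cesàro step. -/
abbrev stub_cesaroOfPointwise : Prop := CesaroStep
/-- rung (fixed `K`, classical). -/
abbrev stub_fixedCutoffEntropy : Prop := FixedCutoffEntropy
/-- support (provable now): the Weyl-law Gaussian lattice sum. -/
abbrev stub_weylEntropySum : Prop := WeylEntropySum
/-- support (provable now, first rung of the lever): the one-mode OU entropy bound. -/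
abbrev stub_ouModeEntropy : Prop := OUModeEntropy

end __Registered

/-! ## Five registered stubs, by name -/

/-- **`stub_pinskerStep`** (registered alias, statement verbatim): budget + dissipation ⇒ K-uniform pointwise mixing —
the tree theorem `pinskerStep` (Csiszár–Kullback–Pinsker for `klDiv`, `|∏ avgObs| ≤ 1`, `expectAt = ∫ · d(gibbsMeasure)`),
by definitional unfolding of the skeleton's abbreviations. [cite: BoucheronLugosiMassart2013, §4.11 Thm. 4.19] -/
theorem stub_pinskerStep : __Registered.stub_pinskerStep :=
  Summit.QuantumFields.YangMills.Theorems.ColdStartUniversality.pinskerStep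

/-- **`stub_cesaroOfPointwise`** (registered alias, statement verbatim; the node SHARED with lines `birth` /
`unitscale_coupling`): K-uniform pointwise mixing ⇒ the crux `UniformColdStartMixing` — the tree theorem `cesaroStep`. [folklore] -/
theorem stub_cesaroOfPointwise : __Registered.stub_cesaroOfPointwise :=
  Summit.QuantumFields.YangMills.Theorems.ColdStartUniversality.cesaroStep

/-- ★ **`stub_fixedCutoffEntropy`** (registered alias, statement verbatim) — THE RUNG of the line: at one fixed cut-off the
cold-start flow has a finite relative entropy w.r.t. Bałaban's step-`K` Gibbs measure at the physical time `ε_K` and dissipates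
it below every `η > 0` after a finite further time, for every cold-start strong solution on any probability space — the tree
theorem `fixedCutoffEntropy` (uniform exponential mixing by Harris/Doeblin + SZZ Lemma 3.3 + uniform density bound; no
log-Sobolev input). [cite: HairerMattingly2011, Theorems 1.2 and 1.3] [cite: ShenZhuZhu2022, §3 Lemma 3.3 (p. 13)] -/
theorem stub_fixedCutoffEntropy : __Registered.stub_fixedCutoffEntropy :=
  Summit.QuantumFields.YangMills.Theorems.ColdStartUniversality.fixedCutoffEntropy

/-- **`stub_weylEntropySum`** (registered alias, statement verbatim): the Weyl-law Gaussian lattice sum is bounded uniformly in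
the box — the tree theorem `weylEntropySum`. [folklore] -/
theorem stub_weylEntropySum : __Registered.stub_weylEntropySum :=
  Summit.QuantumFields.YangMills.Theorems.ColdStartUniversality.weylEntropySum

/-- **`stub_ouModeEntropy`** (registered alias, statement verbatim): the one-mode Ornstein–Uhlenbeck entropy bound — the
tree theorem `ouModeEntropy`. [folklore] -/
theorem stub_ouModeEntropy : __Registered.stub_ouModeEntropy :=
  Summit.QuantumFields.YangMills.Theorems.ColdStartUniversality.ouModeEntropy

/-! ## Composition (kernel-checked) -/

/-- COMPOSITION (the skeleton's kernel, verbatim): budget + dissipation feed the Pinsker node, whose output is the shared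
`PointwiseMixing`; the shared Cesàro step concludes the crux BY NAME. -/
theorem UniformColdStartMixing_of (h1 : __Registered.stub_coldEntropyBudget) (h2 : __Registered.stub_entropyDissipation)
    (h3 : __Registered.stub_pinskerStep) (h4 : __Registered.stub_cesaroOfPointwise) :
    Summit.QuantumFields.YangMills.Theses.ColdStartUniversality.UniformColdStartMixing :=
  h4 (h3 h1 h2)

/-- **The crux modulo its two K-uniform stubs**: `UniformColdStartMixing` follows from `stub_coldEntropyBudget` and
`stub_entropyDissipation` alone (composition `UniformColdStartMixing_of` with the landed `stub_pinskerStep`,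
`stub_cesaroOfPointwise`). -/
theorem uniformColdStartMixing_of_budget_of_dissipation
    (h1 : __Registered.stub_coldEntropyBudget) (h2 : __Registered.stub_entropyDissipation) :
    Summit.QuantumFields.YangMills.Theses.ColdStartUniversality.UniformColdStartMixing :=
  UniformColdStartMixing_of h1 h2 stub_pinskerStep stub_cesaroOfPointwise

end Summit.QuantumFields.YangMills.Cruxes.UniformColdStartMixing.ColdEntropy
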